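import Mathlib

/-!
# The Schur test on a Hilbert basis: bounded operators from matrices with summable rows and columns

Topic `Literature/Analysis/OperatorTheory`. **Schur's test** (I. Schur 1911; Halmos, *A Hilbert Space
Problem Book*, Problem 45; Halmos–Sunder, *Bounded Integral Operators on L² Spaces*, Thm. 5.2): an
infinite matrix `t : ι → ι → 𝕜` whose rows and columns are uniformly absolutely summable,
`∑_j ‖t i j‖ ≤ R` for every `i` and `∑_i ‖t i j‖ ≤ C` for every `j`, is the matrix of a bounded operator
of norm `≤ √(R C)` — on `ℓ²(ι, 𝕜)` (`exists_lpCLM_of_schur_bound`: `(T x)_i = ∑_j t i j x_j`) and, by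
transport along `HilbertBasis.repr`, on any Hilbert space with a Hilbert basis `b`
(`exists_clm_of_schur_bound`: `⟪b i, T (b j)⟫ = t i j`, unique).

Proof (the weighted Cauchy–Schwarz argument with unit weights): for `x ∈ ℓ²`,
`‖∑_j t_ij x_j‖² ≤ (∑_j ‖t_ij‖)(∑_j ‖t_ij‖ ‖x_j‖²) ≤ R ∑_j ‖t_ij‖ ‖x_j‖²`, and summing over a finite set
of `i` and exchanging the (finite/infinite) sums, `∑_i ‖(T x)_i‖² ≤ R C ‖x‖²`. Everything is done with
real series and explicit `Summable` facts (no measure theory): the row series converge absolutely because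
`‖x_j‖ ≤ ‖x‖`.

Consumer (cell `ns-blowup`, MODEL lane, not NS): the relative bound `T = A (x₀ − νΔ)⁻¹` of the
first-order part of a linearised operator against the free resolvent, built from its exact banded
Galerkin matrix (`Summits/NavierStokesRegularity/FluidComputer/SkewCutGalerkinPerturbation.lean`).
Mathlib only; no definitions (existence + uniqueness statements).

## References
* I. Schur, *Bemerkungen zur Theorie der beschränkten Bilinearformen mit unendlich vielen
  Veränderlichen*, J. reine angew. Math. 140 (1911), 1–28, §2.
* P. R. Halmos, *A Hilbert Space Problem Book*, 2nd ed., Springer GTM 19 (1982), Problem 45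
  («Schur test»). [HalmosHSPB1982]
-/

noncomputable section

namespace Literature.Analysis.OperatorTheory.HilbertBasisSchurTest

open Finset Filter
open scoped BigOperators InnerProductSpace

/-! ### Cauchy–Schwarz for a weighted row, finite and infinite -/

section RowCauchySchwarz

variable {ι : Type*}

/-- Weighted Cauchy–Schwarz for a finite row: `(∑ a_j g_j)² ≤ (∑ a_j)(∑ a_j g_j²)` for `a ≥ 0`.
[folklore] -/
private theorem sq_sum_mul_le (s : Finset ι) {a g : ι → ℝ} (ha : ∀ j, 0 ≤ a j) :
    (∑ j ∈ s, a j * g j) ^ 2 ≤ (∑ j ∈ s, a j) * ∑ j ∈ s, a j * g j ^ 2 :=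
  sum_sq_le_sum_mul_sum_of_sq_le_mul s (fun j _ => ha j)
    (fun j _ => mul_nonneg (ha j) (sq_nonneg _)) (fun j _ => by ring_nf; rfl)

/-- `a_j g_j` is summable when `a` and `a g²` are (`a ≥ 0`): `|a g| ≤ (a + a g²)/2`. [folklore] -/
private theorem summable_mul_of_summable_mul_sq {a g : ι → ℝ} (ha : ∀ j, 0 ≤ a j) (hg : ∀ j, 0 ≤ g j)
    (has : Summable a) (hag2 : Summable fun j => a j * g j ^ 2) :
    Summable fun j => a j * g j := by
  have hs : Summable fun j => (a j + a j * g j ^ 2) / 2 := (has.add hag2).div_const 2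
  refine Summable.of_nonneg_of_le (fun j => mul_nonneg (ha j) (hg j)) (fun j => ?_) hs
  -- `a g ≤ (a + a g²) / 2` since `2 g ≤ 1 + g²`
  have h : 2 * g j ≤ 1 + g j ^ 2 := by nlinarith [sq_nonneg (g j - 1)]
  have := mul_le_mul_of_nonneg_left h (ha j)
  linarith

/-- Weighted Cauchy–Schwarz for an infinite row: `(∑' a_j g_j)² ≤ (∑' a_j)(∑' a_j g_j²)` for
`a, g ≥ 0` with `a` and `a g²` summable. [folklore] -/
private theorem sq_tsum_mul_le {a g : ι → ℝ} (ha : ∀ j, 0 ≤ a j) (hg : ∀ j, 0 ≤ g j)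
    (has : Summable a) (hag2 : Summable fun j => a j * g j ^ 2) :
    (∑' j, a j * g j) ^ 2 ≤ (∑' j, a j) * ∑' j, a j * g j ^ 2 := by
  set M : ℝ := (∑' j, a j) * ∑' j, a j * g j ^ 2 with hM
  have hM0 : 0 ≤ M :=
    mul_nonneg (tsum_nonneg ha) (tsum_nonneg fun j => mul_nonneg (ha j) (sq_nonneg _))
  have hag := summable_mul_of_summable_mul_sq ha hg has hag2
  -- every finite partial sum is `≤ √M`
  have hfin : ∀ s : Finset ι, ∑ j ∈ s, a j * g j ≤ Real.sqrt M := fun s => by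
    have h1 : (∑ j ∈ s, a j * g j) ^ 2 ≤ M :=
      (sq_sum_mul_le s ha).trans (mul_le_mul
        (has.sum_le_tsum s fun j _ => ha j)
        (hag2.sum_le_tsum s fun j _ => mul_nonneg (ha j) (sq_nonneg _))
        (sum_nonneg fun j _ => mul_nonneg (ha j) (sq_nonneg _)) (tsum_nonneg ha))
    exact Real.le_sqrt_of_sq_le h1
  have htsum : ∑' j, a j * g j ≤ Real.sqrt M := hag.tsum_le_of_sum_le hfin
  have h0 : 0 ≤ ∑' j, a j * g j := tsum_nonneg fun j => mul_nonneg (ha j) (hg j)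
  calc (∑' j, a j * g j) ^ 2 ≤ Real.sqrt M ^ 2 := pow_le_pow_left₀ h0 htsum 2
    _ = M := Real.sq_sqrt hM0

end RowCauchySchwarz

/-! ### The Schur test on `ℓ²(ι, 𝕜)` -/

section LpTwo

variable {ι 𝕜 : Type*} [RCLike 𝕜]

/-- `‖x‖² = ∑' ‖x_j‖²` on `ℓ²`, as a `HasSum`. [folklore] -/
private theorem hasSum_sq_norm (x : lp (fun _ : ι => 𝕜) 2) :
    HasSum (fun j => ‖x j‖ ^ 2) (‖x‖ ^ 2) := by
  have h := lp.hasSum_norm (p := 2) (by norm_num) x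
  simpa using h

variable (t : ι → ι → 𝕜) {R C : ℝ}

/-- The row series `∑_j t_ij x_j` converges absolutely for `x ∈ ℓ²` when the row is absolutely
summable (`‖x_j‖ ≤ ‖x‖`). [folklore] -/
private theorem summable_row_mul (hrow : ∀ i, Summable fun j => ‖t i j‖) (x : lp (fun _ : ι => 𝕜) 2)
    (i : ι) : Summable fun j => t i j * x j := by
  refine Summable.of_norm_bounded ((hrow i).mul_right ‖x‖) fun j => ?_
  rw [norm_mul]
  exact mul_le_mul_of_nonneg_left (lp.norm_apply_le_norm two_ne_zero x j) (norm_nonneg _)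

/-- The dominating series `∑_j ‖t_ij‖ ‖x_j‖` converges. [folklore] -/
private theorem summable_row_norm_mul (hrow : ∀ i, Summable fun j => ‖t i j‖) (x : lp (fun _ : ι => 𝕜) 2)
    (i : ι) : Summable fun j => ‖t i j‖ * ‖x j‖ :=
  Summable.of_nonneg_of_le (fun _ => mul_nonneg (norm_nonneg _) (norm_nonneg _))
    (fun j => mul_le_mul_of_nonneg_left (lp.norm_apply_le_norm two_ne_zero x j) (norm_nonneg _))
    ((hrow i).mul_right ‖x‖)

/-- The series `∑_j ‖t_ij‖ ‖x_j‖²` converges. [folklore] -/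
private theorem summable_row_norm_mul_sq (hrow : ∀ i, Summable fun j => ‖t i j‖)
    (x : lp (fun _ : ι => 𝕜) 2) (i : ι) : Summable fun j => ‖t i j‖ * ‖x j‖ ^ 2 :=
  Summable.of_nonneg_of_le (fun _ => mul_nonneg (norm_nonneg _) (sq_nonneg _))
    (fun j => mul_le_mul_of_nonneg_left
      (pow_le_pow_left₀ (norm_nonneg _) (lp.norm_apply_le_norm two_ne_zero x j) 2) (norm_nonneg _))
    ((hrow i).mul_right (‖x‖ ^ 2))

/-- Row estimate: `‖∑_j t_ij x_j‖² ≤ R ∑_j ‖t_ij‖ ‖x_j‖²`. [folklore] -/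
private theorem norm_sq_tsum_row_le (hrow : ∀ i, Summable fun j => ‖t i j‖) (hR : ∀ i, ∑' j, ‖t i j‖ ≤ R)
    (x : lp (fun _ : ι => 𝕜) 2) (i : ι) :
    ‖∑' j, t i j * x j‖ ^ 2 ≤ R * ∑' j, ‖t i j‖ * ‖x j‖ ^ 2 := by
  have h1 : ‖∑' j, t i j * x j‖ ≤ ∑' j, ‖t i j‖ * ‖x j‖ := by
    refine (norm_tsum_le_tsum_norm (summable_row_mul t hrow x i).norm).trans (le_of_eq ?_)
    exact tsum_congr fun j => norm_mul _ _
  have h2 := sq_tsum_mul_le (fun j => norm_nonneg (t i j)) (fun j => norm_nonneg (x j)) (hrow i)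
    (summable_row_norm_mul_sq t hrow x i)
  have h3 : 0 ≤ ∑' j, ‖t i j‖ * ‖x j‖ ^ 2 :=
    tsum_nonneg fun j => mul_nonneg (norm_nonneg _) (sq_nonneg _)
  calc ‖∑' j, t i j * x j‖ ^ 2 ≤ (∑' j, ‖t i j‖ * ‖x j‖) ^ 2 :=
        pow_le_pow_left₀ (norm_nonneg _) h1 2
    _ ≤ (∑' j, ‖t i j‖) * ∑' j, ‖t i j‖ * ‖x j‖ ^ 2 := h2
    _ ≤ R * ∑' j, ‖t i j‖ * ‖x j‖ ^ 2 := mul_le_mul_of_nonneg_right (hR i) h3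

/-- **Schur's inequality** (finite in `i`): `∑_{i ∈ s} ‖∑_j t_ij x_j‖² ≤ R C ‖x‖²`.
[cite: HalmosHSPB1982, Problem 45] -/
private theorem sum_norm_sq_tsum_row_le (hrow : ∀ i, Summable fun j => ‖t i j‖) (hR : ∀ i, ∑' j, ‖t i j‖ ≤ R)
    (hcol : ∀ j, Summable fun i => ‖t i j‖) (hC : ∀ j, ∑' i, ‖t i j‖ ≤ C) (hR0 : 0 ≤ R)
    (x : lp (fun _ : ι => 𝕜) 2) (s : Finset ι) :
    ∑ i ∈ s, ‖∑' j, t i j * x j‖ ^ 2 ≤ R * C * ‖x‖ ^ 2 := by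
  have hx := hasSum_sq_norm x
  -- the exchanged sum `∑'_j (∑_{i ∈ s} ‖t_ij‖) ‖x_j‖²`
  have hsw : ∑ i ∈ s, ∑' j, ‖t i j‖ * ‖x j‖ ^ 2 = ∑' j, ∑ i ∈ s, ‖t i j‖ * ‖x j‖ ^ 2 :=
    (Summable.tsum_finsetSum fun i _ => summable_row_norm_mul_sq t hrow x i).symm
  have hcolfin : ∀ j, ∑ i ∈ s, ‖t i j‖ ≤ C := fun j =>
    ((hcol j).sum_le_tsum s fun i _ => norm_nonneg _).trans (hC j)
  have hsum1 : Summable fun j => ∑ i ∈ s, ‖t i j‖ * ‖x j‖ ^ 2 :=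
    summable_sum fun i _ => summable_row_norm_mul_sq t hrow x i
  calc ∑ i ∈ s, ‖∑' j, t i j * x j‖ ^ 2 ≤ ∑ i ∈ s, R * ∑' j, ‖t i j‖ * ‖x j‖ ^ 2 :=
        sum_le_sum fun i _ => norm_sq_tsum_row_le t hrow hR x i
    _ = R * ∑' j, ∑ i ∈ s, ‖t i j‖ * ‖x j‖ ^ 2 := by rw [← mul_sum, hsw]
    _ ≤ R * ∑' j, C * ‖x j‖ ^ 2 := by
        refine mul_le_mul_of_nonneg_left (hsum1.tsum_le_tsum (fun j => ?_)
          (hx.summable.mul_left C)) hR0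
        rw [← sum_mul]
        exact mul_le_mul_of_nonneg_right (hcolfin j) (sq_nonneg _)
    _ = R * C * ‖x‖ ^ 2 := by rw [tsum_mul_left, hx.tsum_eq, mul_assoc]

/-- The row-sum sequence is square summable: `(∑_j t_ij x_j)_i ∈ ℓ²`. [folklore] -/
private theorem memℓp_tsum_row (hrow : ∀ i, Summable fun j => ‖t i j‖) (hR : ∀ i, ∑' j, ‖t i j‖ ≤ R)
    (hcol : ∀ j, Summable fun i => ‖t i j‖) (hC : ∀ j, ∑' i, ‖t i j‖ ≤ C) (hR0 : 0 ≤ R)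
    (x : lp (fun _ : ι => 𝕜) 2) : Memℓp (fun i => ∑' j, t i j * x j) 2 := by
  refine memℓp_gen' (C := R * C * ‖x‖ ^ 2) fun s => ?_
  simpa using sum_norm_sq_tsum_row_le t hrow hR hcol hC hR0 x s

/-- **Schur's test on `ℓ²`**: a matrix with absolutely summable rows (`≤ R`) and columns (`≤ C`)
defines a bounded operator `(T x)_i = ∑_j t_ij x_j` on `ℓ²(ι, 𝕜)` (each row series absolutely
convergent) with `‖T‖ ≤ √(R C)`. [cite: HalmosHSPB1982, Problem 45] -/
theorem exists_lpCLM_of_schur_bound (hrow : ∀ i, Summable fun j => ‖t i j‖)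
    (hR : ∀ i, ∑' j, ‖t i j‖ ≤ R) (hcol : ∀ j, Summable fun i => ‖t i j‖)
    (hC : ∀ j, ∑' i, ‖t i j‖ ≤ C) (hR0 : 0 ≤ R) (hC0 : 0 ≤ C) :
    ∃ T : lp (fun _ : ι => 𝕜) 2 →L[𝕜] lp (fun _ : ι => 𝕜) 2,
      (∀ x i, T x i = ∑' j, t i j * x j) ∧ (∀ (x : lp (fun _ : ι => 𝕜) 2) i,
        Summable fun j => t i j * x j) ∧ ‖T‖ ≤ Real.sqrt (R * C) := by
  let T₀ : lp (fun _ : ι => 𝕜) 2 →ₗ[𝕜] lp (fun _ : ι => 𝕜) 2 :=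
    { toFun := fun x => ⟨fun i => ∑' j, t i j * x j, memℓp_tsum_row t hrow hR hcol hC hR0 x⟩
      map_add' := fun x y => lp.ext (funext fun i => by
        simp only [lp.coeFn_add, Pi.add_apply]
        change ∑' j, t i j * (x j + y j) = (∑' j, t i j * x j) + ∑' j, t i j * y j
        rw [← (summable_row_mul t hrow x i).tsum_add (summable_row_mul t hrow y i)]
        exact tsum_congr fun j => mul_add _ _ _)
      map_smul' := fun c x => lp.ext (funext fun i => by
        simp only [lp.coeFn_smul, Pi.smul_apply, RingHom.id_apply, smul_eq_mul]
        change ∑' j, t i j * (c * x j) = c * ∑' j, t i j * x j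
        rw [← tsum_mul_left]
        exact tsum_congr fun j => by ring) }
  have hT₀ : ∀ x i, T₀ x i = ∑' j, t i j * x j := fun x i => rfl
  have hbound : ∀ x, ‖T₀ x‖ ≤ Real.sqrt (R * C) * ‖x‖ := fun x => by
    refine lp.norm_le_of_forall_sum_le (p := 2) (by norm_num) (by positivity) fun s => ?_
    have h := sum_norm_sq_tsum_row_le t hrow hR hcol hC hR0 x s
    have hsq : (Real.sqrt (R * C) * ‖x‖) ^ 2 = R * C * ‖x‖ ^ 2 := by
      rw [mul_pow, Real.sq_sqrt (mul_nonneg hR0 hC0)]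
    simpa [hT₀, hsq] using h
  exact ⟨T₀.mkContinuous (Real.sqrt (R * C)) hbound, fun x i => rfl, summable_row_mul t hrow,
    T₀.mkContinuous_norm_le (Real.sqrt_nonneg _) hbound⟩

end LpTwo

/-! ### Transport to a Hilbert basis -/

section Basis

variable {ι 𝕜 H : Type*} [RCLike 𝕜] [NormedAddCommGroup H] [InnerProductSpace 𝕜 H]
variable (b : HilbertBasis ι 𝕜 H)

/-- Two bounded operators with the same matrix in a Hilbert basis coincide. [folklore] -/
private theorem clm_eq_of_inner_basis_eq {T T' : H →L[𝕜] H}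
    (h : ∀ i j, ⟪b i, T (b j)⟫_𝕜 = ⟪b i, T' (b j)⟫_𝕜) : T = T' := by
  have hb : ∀ j, T (b j) = T' (b j) := fun j => b.repr.injective (lp.ext (funext fun i => by
    rw [b.repr_apply_apply, b.repr_apply_apply, h i j]))
  refine ContinuousLinearMap.ext_on (s := Set.range (⇑b)) ?_ ?_
  · rw [Submodule.dense_iff_topologicalClosure_eq_top]
    exact b.dense_span
  · rintro _ ⟨j, rfl⟩
    exact hb j

/-- **Schur's test in a Hilbert basis**: a matrix `t` with absolutely summable rows (`≤ R`) and
columns (`≤ C`) is the matrix `⟪b i, T (b j)⟫ = t i j` of a UNIQUE bounded operator `T`, with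
`‖T‖ ≤ √(R C)`; in coordinates `⟪b i, T x⟫ = ∑_j t i j ⟪b j, x⟫` (absolutely convergent).
[cite: HalmosHSPB1982, Problem 45] -/
theorem exists_clm_of_schur_bound (t : ι → ι → 𝕜) {R C : ℝ}
    (hrow : ∀ i, Summable fun j => ‖t i j‖) (hR : ∀ i, ∑' j, ‖t i j‖ ≤ R)
    (hcol : ∀ j, Summable fun i => ‖t i j‖) (hC : ∀ j, ∑' i, ‖t i j‖ ≤ C)
    (hR0 : 0 ≤ R) (hC0 : 0 ≤ C) :
    ∃ T : H →L[𝕜] H, (∀ x i, b.repr (T x) i = ∑' j, t i j * b.repr x j) ∧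
      (∀ x i, Summable fun j => t i j * b.repr x j) ∧
      (∀ i j, ⟪b i, T (b j)⟫_𝕜 = t i j) ∧ ‖T‖ ≤ Real.sqrt (R * C) ∧
      ∀ T' : H →L[𝕜] H, (∀ i j, ⟪b i, T' (b j)⟫_𝕜 = t i j) → T' = T := by
  classical
  obtain ⟨T₀, hT₀, hT₀s, hT₀n⟩ := exists_lpCLM_of_schur_bound t hrow hR hcol hC hR0 hC0
  set T : H →L[𝕜] H :=
    (b.repr.symm.toContinuousLinearEquiv : lp (fun _ : ι => 𝕜) 2 →L[𝕜] H) ∘L T₀ ∘L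
      (b.repr.toContinuousLinearEquiv : H →L[𝕜] lp (fun _ : ι => 𝕜) 2) with hT
  have hTapply : ∀ x, T x = b.repr.symm (T₀ (b.repr x)) := fun x => rfl
  have hcoord : ∀ x i, b.repr (T x) i = ∑' j, t i j * b.repr x j := fun x i => by
    rw [hTapply, LinearIsometryEquiv.apply_symm_apply, hT₀]
  have hmat : ∀ i j, ⟪b i, T (b j)⟫_𝕜 = t i j := fun i j => by
    rw [← b.repr_apply_apply, hcoord, b.repr_self]
    simp_rw [lp.single_apply, Pi.single_apply, mul_ite, mul_one, mul_zero]
    exact tsum_ite_eq j (t i)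
  refine ⟨T, hcoord, fun x i => hT₀s (b.repr x) i, hmat, ?_,
    fun T' hT' => clm_eq_of_inner_basis_eq b fun i j => by rw [hT', hmat]⟩
  · refine ContinuousLinearMap.opNorm_le_bound _ (Real.sqrt_nonneg _) fun x => ?_
    rw [hTapply, LinearIsometryEquiv.norm_map]
    calc ‖T₀ (b.repr x)‖ ≤ ‖T₀‖ * ‖b.repr x‖ := T₀.le_opNorm _
      _ ≤ Real.sqrt (R * C) * ‖b.repr x‖ := mul_le_mul_of_nonneg_right hT₀n (norm_nonneg _)
      _ = Real.sqrt (R * C) * ‖x‖ := by rw [LinearIsometryEquiv.norm_map]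

end Basis

end Literature.Analysis.OperatorTheory.HilbertBasisSchurTest

end
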